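import Summits.NavierStokesRegularity.NavierStokesRegularity.Theorems.TypeICertificateLadderTargetSolitonBridgeEmbedding
import Summits.NavierStokesRegularity.NavierStokesRegularity.Theorems.TypeICertificateLadderTargetSolitonBridgeTailWeak
import Literature.Analysis.FluidPDE.GKPRigidityBackwardUniqueness
import Literature.Analysis.FluidPDE.PineauVicolCylinderRegularity
import Literature.Analysis.FluidPDE.PineauVicolRSSProofs
import Literature.Analysis.FluidPDE.ClassicalSolutionGlue
import Literature.Analysis.FluidPDE.PineauVicolRSS
import Literature.Analysis.FluidPDE.PineauVicolRSSChaeWolf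
import HarnessLib

/-!
# Crux `Target` ≡ `NoTypeIBlowup` (stmt-NavierStokesRegularity-1217), line `killing-twisted-bernoulli-solitons`,
# stub B5b: a NEW STRATUM — Type-I rotated self-similar solitons with SUBCRITICAL TAIL are trivial
# (the blow-up trace of a window soliton does not vanish)

Lead `prover-line-stmt-NavierStokesRegularity-1217-c3-0` (continuation lead c3), 2026-08-16. Registered stub
`solitonBridge_trivial_of_subcritical_tail`.

**Theorem.** Let `(u, p)` be a classical solution of the unforced Navier–Stokes system (`ν = 1`) on
`ℝ³ × [−1, 0)` with the Type-I bound `‖u(t,x)‖ ≤ C₀/(‖x‖ + √−t)` which is the Pineau–Vicol rotated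
self-similar ansatz `u = pvAnsatz α U` of a `C²` profile `U` (ANY rotation rate `α`). If the profile has a
subcritical tail, `‖y‖ ‖U(y)‖ → 0` as `‖y‖ → ∞`, then `U = 0`.

Equivalently: a non-trivial Type-I RSS soliton (a counterexample to Pineau–Vicol's Conjecture 1.1, i.e. to
the line's window stub B5b) has `limsup_{‖y‖→∞} ‖y‖ ‖U(y)‖ > 0` — its profile decays EXACTLY at the
scale-invariant rate `1/‖y‖`, and the blow-up-time trace `u(0, x) = lim_{t↑0} u(t, x)` (a
spiral-homogeneous field of degree `−1` on `ℝ³ ∖ {0}`) is not zero. Within the class (where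
`‖∇U(y)‖ ≲ ‖y‖⁻²`, P–V Lemma 2.1) this is strictly stronger than the remark `U ∈ L³ ⇒ U ≡ 0`
(Escauriaza–Seregin–Šverák via `L^∞_t L³_x`; Pineau–Vicol 2026, p. 4): the genuine difficulty of the window
`α ≈ 1` is carried entirely by the non-zero trace amplitude.

**Proof** (backward uniqueness at the blow-up time). The ansatz field `v` extends `u` to a classical
solution on `(−∞, 0)` with the same apex bound (`solitonBridge_isTypeIAncientMild`). (i) Far field: by
Pineau–Vicol's Lemma 7.1 bounds for Type-I classical solutions on `(−∞,0)`
(`PineauVicol2026.exists_forall_iteratedFDeriv_le_of_typeI`: `‖Dⁿₓv(t,x)‖ ≤ Kₙ max{‖x‖, √−t}^{−(n+1)}`) the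
spatial derivatives of order `≤ 3` are bounded on `{‖x‖ > 1}`, uniformly up to `t = 0`. (ii) Weak vanishing:
the subcritical tail makes `v(t, x) → 0` for `x ≠ 0` as `t ↑ 0`, dominated by `C₀/‖x‖ ∈ L¹_loc`, so
`∫ ⟪v(t), φ⟫ → 0` for every test field (`solitonBridge_tendsto_integral_of_tail`). (iii) After the time
shift `t ↦ t − 4` the tree's packaged Escauriaza–Seregin–Šverák argument
(`IsClassicalNSSolutionOn.curl_eq_zero_of_farField_of_tendsto`: backward uniqueness in half-spaces for the
vorticity in the far field, then unique continuation through spatial boundaries) gives `curl v(t) ≡ 0` on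
`ℝ³` for `t ∈ (−2, 0)`; at `t = −1` the ansatz is the identity, so `curl U ≡ 0`, and an irrotational
divergence-free profile with the decay (1.9) vanishes (`PineauVicol2026.profile_slice_eq_zero_of_curl_eq_zero`).

No definitions; unconditional (trust base Mathlib's axioms). Lands `--supports stmt-NavierStokesRegularity-1217`.
-/

noncomputable section

set_option linter.dupNamespace false

namespace Summit.NavierStokesRegularity.NavierStokesRegularity.Theorems

open Set Function Filter Metric MeasureTheory
open scoped RealInnerProductSpace Topology
open Literature.Analysis.FluidPDE

/-- **Far-field derivative bounds up to the blow-up time** for a Type-I classical solution on `(−∞, 0)`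
(Pineau–Vicol 2026, Lemma 7.1, through the tree's `exists_forall_iteratedFDeriv_le_of_typeI`): on
`{‖x‖ > 1}` the spatial derivatives of orders `n ≤ 3` are bounded by one constant, for all `t < 0`
(`max{‖x‖, √−t} ≥ ‖x‖ > 1` makes the scale factor `≤ 1`). [cite: PineauVicol2026, Lemma 7.1 (arXiv:2607.09619 p. 24)] -/
theorem solitonBridge_tail_farField_bounds {C₀ : ℝ}
    {v : ℝ → EuclideanSpace ℝ (Fin 3) → EuclideanSpace ℝ (Fin 3)}
    {P : ℝ → EuclideanSpace ℝ (Fin 3) → ℝ} (hP : IsClassicalNSSolutionOn (Iio 0) 1 0 v P)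
    (hdec : HasTypeIDecay C₀ v) :
    ∃ K : ℝ, ∀ n ≤ 3, ∀ t < 0, ∀ x : EuclideanSpace ℝ (Fin 3), 1 < ‖x‖ →
      ‖iteratedFDeriv ℝ n (v t) x‖ ≤ K := by
  have hI : ∀ t ∈ Iio (0 : ℝ), ∀ x, ‖v t x‖ ≤ C₀ / (‖x‖ + Real.sqrt (-t)) := fun t ht x => hdec t ht x
  obtain ⟨K₀, hK₀, h0⟩ := PineauVicol2026.exists_forall_iteratedFDeriv_le_of_typeI 0 C₀
  obtain ⟨K₁, hK₁, h1⟩ := PineauVicol2026.exists_forall_iteratedFDeriv_le_of_typeI 1 C₀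
  obtain ⟨K₂, hK₂, h2⟩ := PineauVicol2026.exists_forall_iteratedFDeriv_le_of_typeI 2 C₀
  obtain ⟨K₃, hK₃, h3⟩ := PineauVicol2026.exists_forall_iteratedFDeriv_le_of_typeI 3 C₀
  refine ⟨K₀ + K₁ + K₂ + K₃, fun n hn t ht x hx => ?_⟩
  -- the scale factor is at most one in the far field
  have hfac : ∀ m : ℕ, ((max ‖x‖ (Real.sqrt (-t)))⁻¹) ^ m ≤ 1 := fun m =>
    pow_le_one₀ (inv_nonneg.2 ((norm_nonneg x).trans (le_max_left _ _)))
      (inv_le_one_of_one_le₀ (hx.le.trans (le_max_left _ _)))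
  have hb : ∀ {K : ℝ} {m k : ℕ}, 0 ≤ K →
      ‖iteratedFDeriv ℝ k (v t) x‖ ≤ K * ((max ‖x‖ (Real.sqrt (-t)))⁻¹) ^ m →
      ‖iteratedFDeriv ℝ k (v t) x‖ ≤ K := fun {K m k} hK h =>
    h.trans ((mul_le_mul_of_nonneg_left (hfac m) hK).trans (mul_one K).le)
  interval_cases n
  · have := hb hK₀ (h0 v P hP hI t ht x); linarith
  · have := hb hK₁ (h1 v P hP hI t ht x); linarith
  · have := hb hK₂ (h2 v P hP hI t ht x); linarith
  · have := hb hK₃ (h3 v P hP hI t ht x); linarith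

/-- **NEW STRATUM for B5b — Type-I rotated self-similar solitons with subcritical tail are trivial**
(registered stub `solitonBridge_trivial_of_subcritical_tail`). For a classical Navier–Stokes solution on
`[−1, 0)` with the Type-I bound `‖u(t,x)‖ ≤ C₀/(‖x‖+√−t)` which is the Pineau–Vicol ansatz `pvAnsatz α U` of a
`C²` profile (any `α`): if `‖y‖‖U(y)‖ → 0` at infinity then `U = 0`. Hence a window soliton has a
NON-VANISHING blow-up trace / critical tail amplitude `limsup ‖y‖‖U(y)‖ > 0`. Proof: extension to `(−∞,0)`
(`solitonBridge_isTypeIAncientMild`), far-field bounds (`solitonBridge_tail_farField_bounds`), weak vanishing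
of the slices (`solitonBridge_tendsto_integral_of_tail`), backward uniqueness + unique continuation for the
vorticity of the time-shifted solution on `(0, 4)` (`IsClassicalNSSolutionOn.curl_eq_zero_of_farField_of_tendsto`,
window `(2, 4) ∋ 3 ↔ t = −1`), and the Liouville step for irrotational profiles
(`PineauVicol2026.profile_slice_eq_zero_of_curl_eq_zero`). [cite: EscauriazaSereginSverak2003, Thm. 5.1 and §5] [cite: PineauVicol2026, Conjecture 1.1, Lemma 7.1 (arXiv:2607.09619 pp. 3, 24)] -/
theorem solitonBridge_trivial_of_subcritical_tail :
    ∀ (C₀ α : ℝ) (u : ℝ → EuclideanSpace ℝ (Fin 3) → EuclideanSpace ℝ (Fin 3)) (p : ℝ → EuclideanSpace ℝ (Fin 3) → ℝ) (U : EuclideanSpace ℝ (Fin 3) → EuclideanSpace ℝ (Fin 3)), Literature.Analysis.FluidPDE.IsClassicalNSSolutionOn (Set.Ico (-1) 0) 1 0 u p → (∀ t ∈ Set.Ico (-1 : ℝ) 0, ∀ x : EuclideanSpace ℝ (Fin 3), ‖u t x‖ ≤ C₀ / (‖x‖ + Real.sqrt (-t))) → ContDiff ℝ 2 U → (∀ t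 ∈ Set.Ico (-1 : ℝ) 0, ∀ x : EuclideanSpace ℝ (Fin 3), u t x = Literature.Analysis.FluidPDE.pvAnsatz α (fun y _ => U y) t x) → Filter.Tendsto (fun y : EuclideanSpace ℝ (Fin 3) => ‖y‖ * ‖U y‖) (Filter.cocompact (EuclideanSpace ℝ (Fin 3))) (nhds 0) → U = 0 := by
  intro C₀ α u p U hsol hI hU hA htail
  -- the ansatz field on all of `t < 0`
  set v : ℝ → EuclideanSpace ℝ (Fin 3) → EuclideanSpace ℝ (Fin 3) := pvAnsatz α (fun y _ => U y)
    with hv_def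
  obtain ⟨-, hdec, P, hP⟩ := solitonBridge_isTypeIAncientMild C₀ α u p U hsol hI hA
  -- the time-shifted field `w t = v (t - 4)` is classical on `(0, 4)`
  set w : ℝ → EuclideanSpace ℝ (Fin 3) → EuclideanSpace ℝ (Fin 3) := fun t => v (t + -4) with hw_def
  have hcl : IsClassicalNSSolutionOn (Ioo 0 4) 1 0 w (fun t => P (t + -4)) := by
    have h := hP.comp_add_right (-4)
    refine h.mono (fun t ht => ?_) (uniqueDiffOn_Ioo 0 4)
    show t + -4 ∈ Iio (0 : ℝ)
    simp only [mem_Iio]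
    linarith [ht.2]
  -- (i) far-field derivative bounds on `(2, 4) × {‖x‖ > 1}`
  obtain ⟨K, hK⟩ := solitonBridge_tail_farField_bounds hP hdec
  have hbd : ∀ n ≤ 3, ∀ z ∈ Ioo (2 : ℝ) 4 ×ˢ (closedBall (0 : EuclideanSpace ℝ (Fin 3)) 1)ᶜ,
      ‖iteratedFDeriv ℝ n (w z.1) z.2‖ ≤ K := by
    intro n hn z hz
    obtain ⟨hz1, hz2⟩ := hz
    have ht : z.1 + -4 < 0 := by linarith [hz1.2]
    have hx : 1 < ‖z.2‖ := by
      have h : ¬ (dist z.2 0 ≤ 1) := hz2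
      rw [dist_zero_right] at h
      exact lt_of_not_ge h
    exact hK n hn (z.1 + -4) ht z.2 hx
  -- (ii) weak vanishing of the slices at the blow-up time `t = 4`
  have hprof : ∀ y : EuclideanSpace ℝ (Fin 3), ‖U y‖ ≤ C₀ / (‖y‖ + 1) := profile_bound_of_typeI hI hA
  have hfinal : ∀ φ : EuclideanSpace ℝ (Fin 3) → EuclideanSpace ℝ (Fin 3),
      Literature.Analysis.FunctionSpaces.IsTestFunctionOn (⊤ : TopologicalSpace.Opens (EuclideanSpace ℝ (Fin 3))) φ →
        Tendsto (fun t => ∫ x, ⟪w t x, φ x⟫) (𝓝[<] 4) (𝓝 0) := by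
    intro φ hφ
    have h0 := solitonBridge_tendsto_integral_of_tail C₀ α U hU.continuous hprof htail φ
      hφ.contDiff.continuous hφ.hasCompactSupport
    have hg : Tendsto (fun t : ℝ => t + -4) (𝓝[<] 4) (𝓝[<] 0) := by
      refine tendsto_nhdsWithin_iff.2 ⟨?_, ?_⟩
      · have hc : Tendsto (fun t : ℝ => t + -4) (𝓝 4) (𝓝 ((4 : ℝ) + -4)) :=
          ((continuous_id.add continuous_const).tendsto 4)
        rw [show (4 : ℝ) + -4 = 0 by norm_num] at hc
        exact hc.mono_left nhdsWithin_le_nhds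
      · filter_upwards [self_mem_nhdsWithin] with t ht
        simp only [mem_Iio] at ht ⊢
        linarith
    exact h0.comp hg
  -- (iii) backward uniqueness + unique continuation: the vorticity vanishes on `(2, 4)`
  have hcurl := hcl.curl_eq_zero_of_farField_of_tendsto one_pos (by norm_num) (by norm_num)
    zero_le_one hbd hfinal
  -- at `t = 3 ↔ -1` the ansatz is the profile
  have h3 : (3 : ℝ) ∈ Ioo (2 : ℝ) 4 := ⟨by norm_num, by norm_num⟩
  have hw3 : w 3 = U := by
    funext x
    show pvAnsatz α (fun y _ => U y) (3 + -4) x = U x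
    rw [show (3 : ℝ) + -4 = -1 by norm_num]
    exact pvAnsatz_neg_one α _ x
  have hΩ : ∀ y, curl (fun z => U z) y = 0 := by
    intro y
    have h := hcurl 3 h3 y
    rwa [hw3] at h
  -- Liouville for the irrotational, divergence-free, decaying profile
  have hU2 : ContDiff ℝ 2 (fun q : EuclideanSpace ℝ (Fin 3) × ℝ => U q.1) := hU.comp contDiff_fst
  funext y
  exact PineauVicol2026.profile_slice_eq_zero_of_curl_eq_zero (U := fun z _ => U z) hsol hI hU2 hA le_rfl hΩ y

end Summit.NavierStokesRegularity.NavierStokesRegularity.Theorems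

end
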